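import Mathlib.AlgebraicTopology.SingularHomology.Basic
import Mathlib.Topology.Category.TopPair
import Mathlib.Topology.Category.TopCat.EpiMono
import Mathlib.Topology.Homeomorph.Lemmas
import Mathlib.Algebra.Homology.HomologySequence
import Mathlib.Algebra.Homology.HomologySequenceLemmas
import Mathlib.Algebra.Homology.HomologicalComplexLimits
import Mathlib.Algebra.Homology.HomologicalComplexAbelian
import Mathlib.Algebra.Category.ModuleCat.Abelian
import Mathlib.Algebra.Category.ModuleCat.Limits
import Mathlib.Algebra.Homology.ShortComplex.ModuleCat
import Mathlib.Topology.Homotopy.Basic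
import Literature.AlgebraicTopology.SingularHomology.SingularChains
import HarnessLib

-- provenance: harness21/H21/H21/Prelude/AlgTop/RelativeHomology.lean @ 8ab0aae (interim HEAD d8f2665); M5 mechanical rewrite
/-!
# Relative singular homology of a pair (trunk G04 AlgTop, item C2 `RelativeHomology`)

For a topological space `X` and a subset `A : Set X` we define the relative singular chain
complex `C_•(X, A; M) := coker (C_•(A; M) ⟶ C_•(X; M))` and the relative singular homology
`Hₙ(X, A; M)`, together with the long exact sequence of the pair
`⋯ ⟶ Hₙ(A) ⟶ Hₙ(X) ⟶ Hₙ(X, A) ⟶ Hₙ₋₁(A) ⟶ ⋯`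
(Hatcher, *Algebraic Topology* (2002), §2.1, "Exact sequences and excision", Thm. 2.13 ff.).

Mathlib (pinned) has no relative singular homology; it has the absolute functor
`AlgebraicTopology.singularChainComplexFunctor`, the fact that it preserves monomorphisms, the
category of pairs `TopPair` and the abstract long exact homology sequence of a short exact sequence
of complexes (`CategoryTheory.ShortComplex.ShortExact.δ`, `homology_exact₁/₂/₃`,
`HomologicalComplex.HomologySequence.δ_naturality`). Everything here is a thin layer over these.

## Conventions

As in `Literature.Prelude.AlgTop.SingularChains`: `X : Type u` unbundled, coefficients `R : Type v`
`[CommRing R]`, `M : Type v` an `R`-module, all objects in `ModuleCat.{max u v} R`; pairs are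
`(X, A : Set X)` at Type level, the subspace being the subtype `↥A`.

## Main definitions

* `Literature.singularChainComplex.subsetι R M X A : C_•(↥A; M) ⟶ C_•(X; M)`, the chain map induced by the
  inclusion; *literally* `singularChainComplex.map R M ⟨Subtype.val, continuous_subtype_val⟩`, hence
  definitionally the chain functor applied to `(TopPair.ofSubset A).map` (used by item C4).
* `Literature.relativeSingularChainComplex R M X A := cokernel (subsetι R M X A)` with projection `π` and
  functoriality `map` along maps of pairs.
* `Literature.relativeSingularHomology R M X A n := Hₙ(X, A; M)`, with `map`, `map_id`, `map_comp`,
  `map_eq_of_homotopic`, `ofAbsolute : Hₙ(X) ⟶ Hₙ(X, A)`, the connecting map `δ : Hₙ₊₁(X, A) ⟶ Hₙ(A)`,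
  the three exactness statements of the long exact sequence and `δ_naturality`.
* `Literature.reducedSingularHomology R M X x₀ n := Hₙ(X, {x₀}; M)` — the library's reduced homology
  (Hatcher 2002, Ex. 2.18: `H̃ₙ(X) ≅ Hₙ(X, x₀)`).

## References

* A. Hatcher, *Algebraic Topology*, CUP 2002, §2.1.
-/

noncomputable section

open CategoryTheory Limits AlgebraicTopology

universe u v

namespace Literature.AlgebraicTopology.SingularHomology

variable (R : Type v) [CommRing R] (M : Type v) [AddCommGroup M] [Module R M]
variable {X Y Z : Type u} [TopologicalSpace X] [TopologicalSpace Y] [TopologicalSpace Z]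

/-! ### Maps of pairs -/

/-- The restriction `f| : A → B` of a continuous map `f : X → Y` with `f '' A ⊆ B`, as a continuous
map between the subtypes: the second component of a map of pairs `(X, A) → (Y, B)`
(Hatcher 2002, §2.1, "maps of pairs"). Bundles `Set.MapsTo.restrict` with `Continuous.restrict`. [cite: Hatcher2002, §2.1  "maps of pairs"] -/
def subsetRestrict {A : Set X} {B : Set Y} (f : C(X, Y)) (h : Set.MapsTo f A B) : C(A, B) :=
  ⟨h.restrict f A B, f.continuous.restrict h⟩

/-- `subsetRestrict f h a = ⟨f a, h a.2⟩` (Hatcher 2002, §2.1). [cite: Hatcher2002, §2.1] -/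
@[simp]
lemma subsetRestrict_apply {A : Set X} {B : Set Y} (f : C(X, Y)) (h : Set.MapsTo f A B) (a : A) :
    subsetRestrict f h a = ⟨f a, h a.2⟩ := rfl

/-- Restricting the identity map of pairs gives the identity (Hatcher 2002, §2.1). [cite: Hatcher2002, §2.1] -/
@[simp]
lemma subsetRestrict_id (A : Set X) :
    subsetRestrict (ContinuousMap.id X) (Set.mapsTo_id A) = ContinuousMap.id A := rfl

/-- Restriction is compatible with composition of maps of pairs (Hatcher 2002, §2.1). [cite: Hatcher2002, §2.1] -/
lemma subsetRestrict_comp {A : Set X} {B : Set Y} {C : Set Z} (f : C(X, Y)) (g : C(Y, Z))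
    (hf : Set.MapsTo f A B) (hg : Set.MapsTo g B C) :
    subsetRestrict (g.comp f) (hg.comp hf) = (subsetRestrict g hg).comp (subsetRestrict f hf) :=
  rfl

/-! ### The inclusion of chains of a subspace -/

namespace singularChainComplex

variable (X) in
/-- The chain map `C_•(A; M) ⟶ C_•(X; M)` induced by the inclusion of a subspace `A ⊆ X`
(Hatcher 2002, §2.1, "Exact sequences and excision"). By definition this is
`singularChainComplex.map R M ⟨Subtype.val, continuous_subtype_val⟩`, i.e. the singular chain
functor applied to `(TopPair.ofSubset (X := TopCat.of X) A).map`. [cite: Hatcher2002, §2.1  "Exact sequences and excision"] -/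
abbrev subsetι (A : Set X) : singularChainComplex R M A ⟶ singularChainComplex R M X :=
  singularChainComplex.map R M ⟨Subtype.val, continuous_subtype_val⟩

/-- The inclusion of chains `C_•(A; M) ⟶ C_•(X; M)` is a monomorphism (Hatcher 2002, §2.1: chains
on `A` form a subcomplex of chains on `X`). Proof: an injective continuous map is a mono in `TopCat`
(`TopCat.mono_iff_injective`) and the singular chain functor preserves monos. [cite: Hatcher2002, §2.1: chains on  A  form a subcomplex of] -/
theorem mono_subsetι (A : Set X) : Mono (subsetι R M X A) := by
  haveI : Mono (TopCat.ofHom (⟨Subtype.val, continuous_subtype_val⟩ : C(A, X))) :=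
    (TopCat.mono_iff_injective _).2 Subtype.val_injective
  exact Functor.map_mono _ _

/-- Naturality of `subsetι` with respect to a map of pairs `f : (X, A) → (Y, B)`
(Hatcher 2002, §2.1). [cite: Hatcher2002, §2.1] -/
@[reassoc]
lemma subsetι_comp_map {A : Set X} {B : Set Y} (f : C(X, Y)) (h : Set.MapsTo f A B) :
    subsetι R M X A ≫ singularChainComplex.map R M f =
      singularChainComplex.map R M (subsetRestrict f h) ≫ subsetι R M Y B := by
  rw [← singularChainComplex.map_comp, ← singularChainComplex.map_comp]
  rfl

/-- If `A` is empty, `C_•(A; M) = 0` and so `subsetι = 0` (Hatcher 2002, §2.1: `Hₙ(X, ∅) = Hₙ(X)`). [cite: Hatcher2002, §2.1:  Hₙ(X  ∅] -/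
lemma subsetι_eq_zero_of_isEmpty (A : Set X) [IsEmpty A] : subsetι R M X A = 0 := by
  ext n : 1
  exact singularChainComplex.hom_ext fun σ _ ↦
    isEmptyElim (SingularSimplex.toContinuousMap σ (Classical.arbitrary _))

/-- If `A = univ`, the inclusion of chains is an isomorphism (the inclusion `univ → X` is a
homeomorphism) (Hatcher 2002, §2.1: `Hₙ(X, X) = 0`). [cite: Hatcher2002, §2.1:  Hₙ(X  X] -/
theorem isIso_subsetι_univ : IsIso (subsetι R M X Set.univ) := by
  haveI : IsIso (TopCat.ofHom (⟨Subtype.val, continuous_subtype_val⟩ : C((Set.univ : Set X), X))) :=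
    (TopCat.isoOfHomeo (X := TopCat.of (Set.univ : Set X)) (Y := TopCat.of X)
      (Homeomorph.Set.univ X)).isIso_hom
  exact Functor.map_isIso _ _

end singularChainComplex

/-! ### The relative singular chain complex -/

variable (X) in
/-- The relative singular chain complex `C_•(X, A; M) := C_•(X; M) / C_•(A; M)` of the pair
`(X, A)`, realised as the cokernel of `singularChainComplex.subsetι` in
`ChainComplex (ModuleCat R) ℕ` (Hatcher 2002, §2.1, "Exact sequences and excision"). [cite: Hatcher2002, §2.1  "Exact sequences and excision"] -/
abbrev relativeSingularChainComplex (A : Set X) : ChainComplex (ModuleCat.{max u v} R) ℕ :=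
  cokernel (singularChainComplex.subsetι R M X A)

namespace relativeSingularChainComplex

variable (X) in
/-- The quotient chain map `C_•(X; M) ⟶ C_•(X, A; M)` (Hatcher 2002, §2.1); `cokernel.π`. [cite: Hatcher2002, §2.1] -/
abbrev π (A : Set X) : singularChainComplex R M X ⟶ relativeSingularChainComplex R M X A :=
  cokernel.π (singularChainComplex.subsetι R M X A)

/-- `π` is an epimorphism (Hatcher 2002, §2.1). [cite: Hatcher2002, §2.1] -/
theorem epi_π (A : Set X) : Epi (π R M X A) :=
  inferInstanceAs (Epi (cokernel.π _))

/-- `subsetι ≫ π = 0` (Hatcher 2002, §2.1); `cokernel.condition` (already a simp lemma). [cite: Hatcher2002, §2.1] -/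
@[reassoc]
lemma subsetι_comp_π (A : Set X) : singularChainComplex.subsetι R M X A ≫ π R M X A = 0 :=
  cokernel.condition _

/-- The short exact sequence of chain complexes `0 ⟶ C_•(A) ⟶ C_•(X) ⟶ C_•(X, A) ⟶ 0`
(Hatcher 2002, §2.1, display before Thm. 2.13). Proof: `π` is the cokernel of the mono `subsetι`
(`ShortComplex.exact_of_g_is_cokernel`). [cite: Hatcher2002, §2.1  display before Thm. 2.13] -/
theorem shortExact_subsetι_π (X : Type u) [TopologicalSpace X] (A : Set X) :
    (ShortComplex.mk (singularChainComplex.subsetι R M X A) (π R M X A)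
      (cokernel.condition _)).ShortExact := by
  haveI := singularChainComplex.mono_subsetι R M (X := X) A
  haveI := epi_π R M (X := X) A
  exact ShortComplex.ShortExact.mk'
    (ShortComplex.exact_of_g_is_cokernel _ (cokernelIsCokernel _)) inferInstance inferInstance

/-- The chain map `C_•(X, A; M) ⟶ C_•(Y, B; M)` induced by a map of pairs `f : (X, A) → (Y, B)`,
i.e. a continuous `f : X → Y` with `f '' A ⊆ B` (Hatcher 2002, §2.1); `cokernel.map`. [cite: Hatcher2002, §2.1] -/
def map {A : Set X} {B : Set Y} (f : C(X, Y)) (h : Set.MapsTo f A B) :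
    relativeSingularChainComplex R M X A ⟶ relativeSingularChainComplex R M Y B :=
  cokernel.map _ _ (singularChainComplex.map R M (subsetRestrict f h))
    (singularChainComplex.map R M f) (singularChainComplex.subsetι_comp_map R M f h)

/-- `π ≫ map f = f♯ ≫ π` (Hatcher 2002, §2.1). [cite: Hatcher2002, §2.1] -/
@[reassoc (attr := simp)]
lemma π_comp_map {A : Set X} {B : Set Y} (f : C(X, Y)) (h : Set.MapsTo f A B) :
    π R M X A ≫ map R M f h = singularChainComplex.map R M f ≫ π R M Y B :=
  cokernel.π_desc _ _ _

/-- `map 𝟙 = 𝟙` on relative chains (Hatcher 2002, §2.1). [cite: Hatcher2002, §2.1] -/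
@[simp]
lemma map_id (A : Set X) : map R M (ContinuousMap.id X) (Set.mapsTo_id A) = 𝟙 _ := by
  haveI := epi_π R M (X := X) A
  rw [← cancel_epi (π R M X A), π_comp_map, singularChainComplex.map_id]
  simp

/-- `map (g ∘ f) = map f ≫ map g` on relative chains (Hatcher 2002, §2.1). [cite: Hatcher2002, §2.1] -/
@[reassoc]
lemma map_comp {A : Set X} {B : Set Y} {C : Set Z} (f : C(X, Y)) (g : C(Y, Z))
    (hf : Set.MapsTo f A B) (hg : Set.MapsTo g B C) :
    map R M (g.comp f) (hg.comp hf) = map R M f hf ≫ map R M g hg := by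
  haveI := epi_π R M (X := X) A
  rw [← cancel_epi (π R M X A), π_comp_map, π_comp_map_assoc, π_comp_map,
    singularChainComplex.map_comp, Category.assoc]

/-- The morphism of short exact sequences of chain complexes induced by a map of pairs
`f : (X, A) → (Y, B)` (Hatcher 2002, §2.1, naturality of the long exact sequence). [cite: Hatcher2002, §2.1  naturality of the long exact seque] -/
def shortComplexMap {A : Set X} {B : Set Y} (f : C(X, Y)) (h : Set.MapsTo f A B) :
    ShortComplex.mk (singularChainComplex.subsetι R M X A) (π R M X A) (cokernel.condition _) ⟶
      ShortComplex.mk (singularChainComplex.subsetι R M Y B) (π R M Y B) (cokernel.condition _) :=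
  ShortComplex.homMk (singularChainComplex.map R M (subsetRestrict f h))
    (singularChainComplex.map R M f) (map R M f h)
    (singularChainComplex.subsetι_comp_map R M f h).symm (π_comp_map R M f h).symm

/-- If `A` is empty, `π : C_•(X) ⟶ C_•(X, A)` is an isomorphism (Hatcher 2002, §2.1:
`Hₙ(X, ∅) = Hₙ(X)`). [cite: Hatcher2002, §2.1:  Hₙ(X  ∅] -/
theorem isIso_π_of_isEmpty (A : Set X) [IsEmpty A] : IsIso (π R M X A) :=
  cokernel.π_of_zero (singularChainComplex.subsetι_eq_zero_of_isEmpty R M A)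

/-- If `A = univ`, the relative chain complex `C_•(X, X)` is zero (Hatcher 2002, §2.1). [cite: Hatcher2002, §2.1] -/
theorem isZero_univ : IsZero (relativeSingularChainComplex R M X Set.univ) := by
  haveI := singularChainComplex.isIso_subsetι_univ R M (X := X)
  exact isZero_cokernel_of_epi _

end relativeSingularChainComplex

/-! ### Relative singular homology -/

variable (X) in
/-- The `n`-th relative singular homology `Hₙ(X, A; M)` of the pair `(X, A)` with coefficients in
the `R`-module `M`: the `n`-th homology of `relativeSingularChainComplex R M X A`
(Hatcher 2002, §2.1, "Exact sequences and excision"). [cite: Hatcher2002, §2.1  "Exact sequences and excision"] -/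
abbrev relativeSingularHomology (A : Set X) (n : ℕ) : ModuleCat.{max u v} R :=
  (relativeSingularChainComplex R M X A).homology n

namespace relativeSingularHomology

/-- The induced map `f_* : Hₙ(X, A; M) ⟶ Hₙ(Y, B; M)` of a map of pairs `f : (X, A) → (Y, B)`
(Hatcher 2002, §2.1); `HomologicalComplex.homologyMap` of `relativeSingularChainComplex.map`. [cite: Hatcher2002, §2.1] -/
def map {A : Set X} {B : Set Y} (f : C(X, Y)) (h : Set.MapsTo f A B) (n : ℕ) :
    relativeSingularHomology R M X A n ⟶ relativeSingularHomology R M Y B n :=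
  HomologicalComplex.homologyMap (relativeSingularChainComplex.map R M f h) n

/-- `𝟙_* = 𝟙` on relative homology (Hatcher 2002, §2.1). [cite: Hatcher2002, §2.1] -/
@[simp]
lemma map_id (A : Set X) (n : ℕ) : map R M (ContinuousMap.id X) (Set.mapsTo_id A) n = 𝟙 _ := by
  rw [map, relativeSingularChainComplex.map_id, HomologicalComplex.homologyMap_id]

/-- `(g ∘ f)_* = g_* ∘ f_*` on relative homology (Hatcher 2002, §2.1). [cite: Hatcher2002, §2.1] -/
@[reassoc]
lemma map_comp {A : Set X} {B : Set Y} {C : Set Z} (f : C(X, Y)) (g : C(Y, Z))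
    (hf : Set.MapsTo f A B) (hg : Set.MapsTo g B C) (n : ℕ) :
    map R M (g.comp f) (hg.comp hf) n = map R M f hf n ≫ map R M g hg n := by
  rw [map, relativeSingularChainComplex.map_comp, HomologicalComplex.homologyMap_comp]
  rfl

/-- Homotopy invariance for pairs: if `F` is a homotopy from `f` to `g` through maps of pairs
`(X, A) → (Y, B)` (i.e. `F(t, a) ∈ B` for all `a ∈ A`), then `f_* = g_*` on `Hₙ(X, A; M)`
(Hatcher 2002, §2.1, Prop. 2.19 / Ex. 2.27, via the prism operator). [cite: Hatcher2002, §2.1  Prop. 2.19 / Ex. 2.27  via the pri] -/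
def map_eq_of_homotopic : Prop :=
  ∀ {A : Set X} {B : Set Y} {f g : C(X, Y)} (hf : Set.MapsTo f A B) (hg : Set.MapsTo g A B) (F : ContinuousMap.Homotopy f g) (hF : ∀ tx : unitInterval × X, tx.2 ∈ A → F tx ∈ B) (n : ℕ),
    map R M f hf n = map R M g hg n

variable (X) in
/-- The map `j_* : Hₙ(X; M) ⟶ Hₙ(X, A; M)` induced by the quotient `C_•(X) ⟶ C_•(X, A)`
(Hatcher 2002, §2.1, the map `j_*` of the long exact sequence, Thm. 2.13 ff.). [cite: Hatcher2002, §2.1  the map  j_   of the long exact se] -/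
def ofAbsolute (A : Set X) (n : ℕ) : singularHomology R M X n ⟶ relativeSingularHomology R M X A n :=
  HomologicalComplex.homologyMap (relativeSingularChainComplex.π R M X A) n

/-- Naturality of `j_*`: `j_* ∘ f_* = f_* ∘ j_*` (Hatcher 2002, §2.1). [cite: Hatcher2002, §2.1] -/
@[reassoc]
lemma ofAbsolute_comp_map {A : Set X} {B : Set Y} (f : C(X, Y)) (h : Set.MapsTo f A B) (n : ℕ) :
    ofAbsolute R M X A n ≫ map R M f h n = singularHomology.map R M f n ≫ ofAbsolute R M Y B n := by
  rw [ofAbsolute, map, ← HomologicalComplex.homologyMap_comp,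
    relativeSingularChainComplex.π_comp_map, HomologicalComplex.homologyMap_comp]
  rfl

variable (X) in
/-- The connecting homomorphism `∂ : Hₙ₊₁(X, A; M) ⟶ Hₙ(A; M)` of the pair `(X, A)`
(Hatcher 2002, §2.1, Thm. 2.13 ff.: `∂[c] = [∂c]`); the `ShortComplex.ShortExact.δ` of the short
exact sequence of chain complexes `0 ⟶ C_•(A) ⟶ C_•(X) ⟶ C_•(X, A) ⟶ 0`.
Relies on: `relativeSingularChainComplex.shortExact_subsetι_π` (proved). [cite: Hatcher2002, §2.1  Thm. 2.13 ff.:  ∂ c] -/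
def δ (A : Set X) (n : ℕ) : relativeSingularHomology R M X A (n + 1) ⟶ singularHomology R M A n :=
  (relativeSingularChainComplex.shortExact_subsetι_π R M X A).δ (n + 1) n rfl

/-- `i_* ≫ j_* = 0` in the long exact sequence of the pair (Hatcher 2002, §2.1). [cite: Hatcher2002, §2.1] -/
@[reassoc (attr := simp)]
lemma map_comp_ofAbsolute (A : Set X) (n : ℕ) :
    singularHomology.map R M (⟨Subtype.val, continuous_subtype_val⟩ : C(A, X)) n ≫
      ofAbsolute R M X A n = 0 := by
  rw [singularHomology.map, ofAbsolute, ← HomologicalComplex.homologyMap_comp,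
    relativeSingularChainComplex.subsetι_comp_π, HomologicalComplex.homologyMap_zero]

/-- `j_* ≫ ∂ = 0` in the long exact sequence of the pair (Hatcher 2002, §2.1). [cite: Hatcher2002, §2.1] -/
@[reassoc (attr := simp)]
lemma ofAbsolute_comp_δ (A : Set X) (n : ℕ) : ofAbsolute R M X A (n + 1) ≫ δ R M X A n = 0 :=
  (relativeSingularChainComplex.shortExact_subsetι_π R M X A).comp_δ (n + 1) n rfl

/-- `∂ ≫ i_* = 0` in the long exact sequence of the pair (Hatcher 2002, §2.1). [cite: Hatcher2002, §2.1] -/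
@[reassoc (attr := simp)]
lemma δ_comp_map (A : Set X) (n : ℕ) :
    δ R M X A n ≫ singularHomology.map R M (⟨Subtype.val, continuous_subtype_val⟩ : C(A, X)) n = 0 :=
  (relativeSingularChainComplex.shortExact_subsetι_π R M X A).δ_comp (n + 1) n rfl

/-- Exactness of `Hₙ(A) ⟶ Hₙ(X) ⟶ Hₙ(X, A)` (Hatcher 2002, Thm. 2.13 ff., long exact sequence of
the pair). [cite: Hatcher2002, Thm. 2.13 ff.  long exact sequence of th] -/
theorem exact_map_ofAbsolute (A : Set X) (n : ℕ) :
    (ShortComplex.mk _ _ (map_comp_ofAbsolute R M A n)).Exact :=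
  (relativeSingularChainComplex.shortExact_subsetι_π R M X A).homology_exact₂ n

/-- Exactness of `Hₙ₊₁(X) ⟶ Hₙ₊₁(X, A) ⟶ Hₙ(A)` (Hatcher 2002, Thm. 2.13 ff., long exact sequence
of the pair). [cite: Hatcher2002, Thm. 2.13 ff.  long exact sequence of th] -/
theorem exact_ofAbsolute_δ (A : Set X) (n : ℕ) :
    (ShortComplex.mk _ _ (ofAbsolute_comp_δ R M A n)).Exact :=
  (relativeSingularChainComplex.shortExact_subsetι_π R M X A).homology_exact₃ (n + 1) n rfl

/-- Exactness of `Hₙ₊₁(X, A) ⟶ Hₙ(A) ⟶ Hₙ(X)` (Hatcher 2002, Thm. 2.13 ff., long exact sequence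
of the pair). [cite: Hatcher2002, Thm. 2.13 ff.  long exact sequence of th] -/
theorem exact_δ_map (A : Set X) (n : ℕ) :
    (ShortComplex.mk _ _ (δ_comp_map R M A n)).Exact :=
  (relativeSingularChainComplex.shortExact_subsetι_π R M X A).homology_exact₁ (n + 1) n rfl

/-- Naturality of the connecting homomorphism: for a map of pairs `f : (X, A) → (Y, B)`,
`(f|_A)_* ∘ ∂ = ∂ ∘ f_*` (Hatcher 2002, §2.1, naturality paragraph after Thm. 2.16). [cite: Hatcher2002, §2.1  naturality paragraph after Thm. 2] -/
@[reassoc]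
theorem δ_naturality {A : Set X} {B : Set Y} (f : C(X, Y)) (h : Set.MapsTo f A B) (n : ℕ) :
    δ R M X A n ≫ singularHomology.map R M (subsetRestrict f h) n =
      map R M f h (n + 1) ≫ δ R M Y B n :=
  HomologicalComplex.HomologySequence.δ_naturality
    (relativeSingularChainComplex.shortComplexMap R M f h)
    (relativeSingularChainComplex.shortExact_subsetι_π R M X A)
    (relativeSingularChainComplex.shortExact_subsetι_π R M Y B) (n + 1) n rfl

/-- If `A` is empty, `j_* : Hₙ(X) ⟶ Hₙ(X, A)` is an isomorphism (Hatcher 2002, §2.1: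
`Hₙ(X, ∅) = Hₙ(X)`). [cite: Hatcher2002, §2.1:  Hₙ(X  ∅] -/
theorem isIso_ofAbsolute_of_isEmpty (A : Set X) [IsEmpty A] (n : ℕ) :
    IsIso (ofAbsolute R M X A n) := by
  haveI := relativeSingularChainComplex.isIso_π_of_isEmpty R M (X := X) A
  exact inferInstanceAs
    (IsIso ((HomologicalComplex.homologyFunctor _ _ n).map (relativeSingularChainComplex.π R M X A)))

variable (X) in
/-- `Hₙ(X; M) ≅ Hₙ(X, ∅; M)`, the isomorphism `j_*` for the empty subspace (Hatcher 2002, §2.1).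
Relies on: `relativeSingularHomology.isIso_ofAbsolute_of_isEmpty` (proved). [cite: Hatcher2002, §2.1] -/
def emptyIso (n : ℕ) : singularHomology R M X n ≅ relativeSingularHomology R M X ∅ n :=
  haveI := isIso_ofAbsolute_of_isEmpty R M (X := X) ∅ n
  asIso (ofAbsolute R M X ∅ n)

/-- The underlying morphism of `emptyIso` is `j_* = ofAbsolute` (Hatcher 2002, §2.1). [cite: Hatcher2002, §2.1] -/
@[simp]
lemma emptyIso_hom (n : ℕ) : (emptyIso R M X n).hom = ofAbsolute R M X ∅ n := rfl

end relativeSingularHomology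

/-- `Hₙ(X, X; M) = 0` (Hatcher 2002, §2.1, e.g. from exactness of the long exact sequence; here
directly because `C_•(X, X) = 0`). [cite: Hatcher2002, §2.1  e.g. from exactness of the long ex] -/
theorem isZero_relativeSingularHomology_univ (n : ℕ) :
    IsZero (relativeSingularHomology R M X Set.univ n) :=
  Functor.map_isZero (HomologicalComplex.homologyFunctor _ _ n)
    (relativeSingularChainComplex.isZero_univ R M)

/-! ### Reduced homology -/

variable (X) in
/-- Reduced singular homology `H̃ₙ(X; M)`, *defined* as the relative homology `Hₙ(X, {x₀}; M)` of
`X` relative to a base point; for any `x₀` this agrees with the kernel-of-augmentation definition,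
`H̃ₙ(X) ≅ Hₙ(X, x₀)` (Hatcher 2002, Ex. 2.18). This is the library's reduced homology; there is
no separate `ker ε` model. [cite: Hatcher2002, Ex. 2.18] -/
abbrev reducedSingularHomology (x₀ : X) (n : ℕ) : ModuleCat.{max u v} R :=
  relativeSingularHomology R M X {x₀} n

/-! ### A vanishing criterion for `Hₙ₊₁(X, A)` from the exact sequence of the pair -/

/-- **`Hₙ₊₁(X, A; M) = 0` if `Hₙ₊₁(A) → Hₙ₊₁(X)` is onto and `Hₙ(A) → Hₙ(X)` is one-to-one**
(Hatcher 2002, §2.1, exact sequence of the pair, Thm. 2.13 ff.: in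
`Hₙ₊₁(A) → Hₙ₊₁(X) →j Hₙ₊₁(X, A) →∂ Hₙ(A) → Hₙ(X)` one gets `j_* = 0` and `∂ = 0`, and exactness at
`Hₙ₊₁(X, A)` gives `0`). In particular all `Hₙ₊₁(X, A; M)` vanish when the inclusion `A ↪ X`
induces isomorphisms on all homology groups, as in Hatcher's proof of Cor. 4.33 ("All the groups
`Hₙ(Y, X)` are zero from the long exact sequence of homology") or for an h-cobordism; this is the
coefficient-general home of that argument (the `ℤ`-coefficient instance
`Literature.Topology.FourManifolds.isZero_relativeSingularHomology_succ_of_isIso` of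
`Literature/Topology/FourManifolds/HCobordismMorseComplex.lean` predates it).
[cite: Hatcher2002, §2.1 (exact sequence of the pair, Thm. 2.13 ff.)] -/
theorem isZero_relativeSingularHomology_succ_of_epi_of_mono (A : Set X) (n : ℕ)
    [Epi (singularHomology.map R M (⟨Subtype.val, continuous_subtype_val⟩ : C(A, X)) (n + 1))]
    [Mono (singularHomology.map R M (⟨Subtype.val, continuous_subtype_val⟩ : C(A, X)) n)] :
    IsZero (relativeSingularHomology R M X A (n + 1)) :=
  (relativeSingularHomology.exact_ofAbsolute_δ R M (X := X) A n).isZero_of_both_zeros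
    (zero_of_epi_comp (singularHomology.map R M
      (⟨Subtype.val, continuous_subtype_val⟩ : C(A, X)) (n + 1))
      (relativeSingularHomology.map_comp_ofAbsolute R M A (n + 1)))
    (zero_of_comp_mono (singularHomology.map R M
      (⟨Subtype.val, continuous_subtype_val⟩ : C(A, X)) n)
      (relativeSingularHomology.δ_comp_map R M A n))

/-- **`Hₙ₊₁(X, A; M) = 0` for all `n` when `A ↪ X` induces isomorphisms on all `Hₖ(-; M)`**
(Hatcher 2002, §2.1, exact sequence of the pair; the form used in the proof of Cor. 4.33).
[cite: Hatcher2002, §2.1 (exact sequence of the pair, Thm. 2.13 ff.)] -/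
theorem isZero_relativeSingularHomology_succ_of_isIso_map (A : Set X)
    (h : ∀ k, IsIso (singularHomology.map R M (⟨Subtype.val, continuous_subtype_val⟩ : C(A, X)) k))
    (n : ℕ) : IsZero (relativeSingularHomology R M X A (n + 1)) := by
  haveI := h (n + 1)
  haveI := h n
  exact isZero_relativeSingularHomology_succ_of_epi_of_mono R M A n

end Literature.AlgebraicTopology.SingularHomology
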